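import Literature.Topology.FourManifolds.SmoothMax
import Literature.Topology.FourManifolds.CappedBallLid
import Mathlib.Analysis.InnerProductSpace.Calculus
import HarnessLib

/-!
# The solid of the step: the sphere's ball side, or the big-ball truncated complement

Topic `Literature/Topology/FourManifolds`; fact seat of Alexander's theorem
(`provefact-Literature.Topology.FourManifolds.SphereEmbedding.schoenflies_exists_ball`, Schultens
(2014), Thm. 3.2.5).  **Everything in this file is proved; no definitions, no named facts.**

Schultens (2014), proof of Thm. 3.2.5 (PDF p. 45), runs the induction in `S³ = ℝ³ ∪ ∞`, where
both complementary regions of the sphere `S` are available ("a 3-ball … to the other side!",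
Cor. 3.2.6).  In `ℝ³` the step absorbs a disc of `S` through the planar disc `D`; when `D` lies
outside the bounded region of `S` the solid to sweep through is the complement, which we
truncate by a large round sphere `{‖x‖ = R}` (placed in the kept part `E₁`).  After the tube
normal form (`CircleNormalForm.exists_tubeNormalForm`, `G = σ(ρ² - 1)` on the tube, `σ = ±1`):

* `SolidFunction.exists_solidFunction` — a smooth proper regular `F_X` with the tube normal
  form `F_X = ρ² - 1` of `CappedBallData.StepNF`, zero set `{G = 0} ∪ T₀` with `T₀ = ∅`
  (`σ = 1`, `F_X = G`) or `T₀ = {‖x‖ = R}` far away (`σ = -1`,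
  `F_X = (-G) ⊔_δ (‖x‖² - R²)`, the smooth maximum of `SmoothMax.lean`).

## References
* J. Schultens, *Introduction to 3-Manifolds*, GSM 151, AMS (2014), proof of Thm. 3.2.5 and
  Cor. 3.2.6 (PDF p. 45).
-/

noncomputable section

open Set Metric Filter Topology Function Module
open scoped ContDiff RealInnerProductSpace

namespace Literature.Topology.FourManifolds.SolidFunction

open CappedBallLid

set_option maxHeartbeats 1600000 in
/-- **The solid of the step** (see the module docstring). [cite: Schultens2014, proof of Thm. 3.2.5 and Cor. 3.2.6 (PDF p. 45)] -/
theorem exists_solidFunction {G : EuclideanSpace ℝ (Fin 3) → ℝ} (hG : ContDiff ℝ ∞ G)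
    {K' : Set (EuclideanSpace ℝ (Fin 3))} (hK' : IsCompact K') {ε₀ : ℝ} (hε₀ : 0 < ε₀)
    (hGK : ∀ x, G x ≤ ε₀ → x ∈ K') (hreg : ∀ x, G x = 0 → fderiv ℝ G x ≠ 0)
    {σ : ℝ} (hσ : σ = 1 ∨ σ = -1) {w₀ η₀ : ℝ} (hw₀ : 0 < w₀) (hη₀ : 0 < η₀)
    (hNF : ∀ x, hsq x ≤ (1 + 3 * w₀) ^ 2 → |x 2| ≤ η₀ → G x = σ * (hsq x - 1)) :
    ∃ (FX : EuclideanSpace ℝ (Fin 3) → ℝ) (T₀ : Set (EuclideanSpace ℝ (Fin 3))) (R₁ ε₁ : ℝ),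
      ContDiff ℝ ∞ FX ∧ 0 < ε₁ ∧ IsCompact {x | FX x ≤ ε₁} ∧ (∀ x, FX x = 0 → fderiv ℝ FX x ≠ 0) ∧
      (∀ x, hsq x ≤ (1 + 3 * w₀) ^ 2 → |x 2| ≤ η₀ → FX x = hsq x - 1) ∧
      {x | FX x = 0} = {x | G x = 0} ∪ T₀ ∧ IsClosed T₀ ∧ 0 < R₁ ∧ (∀ x ∈ T₀, R₁ ≤ ‖x‖) ∧
      K' ⊆ ball 0 R₁ ∧ {x | hsq x ≤ (1 + 3 * w₀) ^ 2 ∧ |x 2| ≤ η₀} ⊆ ball 0 R₁ ∧ (∀ x ∈ T₀, G x ≠ 0) := by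
  -- a ball containing `K'` and the tube
  set Tube : Set (EuclideanSpace ℝ (Fin 3)) := {x | hsq x ≤ (1 + 3 * w₀) ^ 2 ∧ |x 2| ≤ η₀} with hTube
  have hTube_bdd : Tube ⊆ closedBall 0 ((1 + 3 * w₀) + η₀) := by
    rintro x ⟨h1, h2⟩
    rw [mem_closedBall_zero_iff, EuclideanSpace.norm_eq]
    have hsum : ∑ i : Fin 3, x i ^ 2 = hsq x + (x 2) ^ 2 := by simp [Fin.sum_univ_three, hsq]
    simp only [Real.norm_eq_abs, sq_abs]
    rw [hsum]
    calc Real.sqrt (hsq x + x 2 ^ 2) ≤ Real.sqrt (((1 + 3 * w₀) + η₀) ^ 2) := by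
          apply Real.sqrt_le_sqrt
          have : x 2 ^ 2 ≤ η₀ ^ 2 := by rw [← sq_abs]; exact pow_le_pow_left₀ (abs_nonneg _) h2 2
          nlinarith
      _ = (1 + 3 * w₀) + η₀ := Real.sqrt_sq (by positivity)
  obtain ⟨B₀, hB₀⟩ := (hK'.isBounded.union (isBounded_closedBall (x := (0 : EuclideanSpace ℝ (Fin 3)))
    (r := (1 + 3 * w₀) + η₀))).subset_closedBall 0
  set B : ℝ := max B₀ 1 with hB
  have hB1 : 1 ≤ B := le_max_right _ _
  have hKB : K' ⊆ closedBall 0 B := fun x hx => closedBall_subset_closedBall (le_max_left _ _) (hB₀ (Or.inl hx))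
  have hTB : Tube ⊆ closedBall 0 B := fun x hx => closedBall_subset_closedBall (le_max_left _ _) (hB₀ (Or.inr (hTube_bdd hx)))
  have hZK : ∀ x, G x = 0 → x ∈ K' := fun x hx => hGK x (by rw [hx]; exact hε₀.le)
  rcases hσ with hσ1 | hσm
  · -- the ball side: `F_X = G`
    refine ⟨G, ∅, B + 1, ε₀, hG, hε₀, hK'.of_isClosed_subset (isClosed_le hG.continuous continuous_const) hGK, hreg,
      fun x h1 h2 => by rw [hNF x h1 h2, hσ1, one_mul], by simp, isClosed_empty, by linarith, by simp, ?_, ?_, by simp⟩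
    · exact fun x hx => mem_ball_zero_iff.2 (lt_of_le_of_lt (mem_closedBall_zero_iff.1 (hKB hx)) (by linarith))
    · exact fun x hx => mem_ball_zero_iff.2 (lt_of_le_of_lt (mem_closedBall_zero_iff.1 (hTB hx)) (by linarith))
  · -- the complement side, truncated by a big ball
    obtain ⟨P, hPs, hP0, hP1, hPd, hPge, hPle⟩ := SmoothMax.exists_smoothPosPart
    set δ : ℝ := ε₀ / 2 with hδ
    have hδ0 : 0 < δ := by positivity
    -- an upper bound for `G` on the ball of radius `B`
    obtain ⟨Gmax, hGmax⟩ : ∃ C, ∀ x ∈ closedBall (0 : EuclideanSpace ℝ (Fin 3)) B, G x ≤ C := by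
      obtain ⟨C, hC⟩ := (isCompact_closedBall (0 : EuclideanSpace ℝ (Fin 3)) B).exists_bound_of_continuousOn hG.continuous.continuousOn
      exact ⟨C, fun x hx => (le_abs_self _).trans ((Real.norm_eq_abs _).symm.le.trans (hC x hx))⟩
    -- the radius
    set R : ℝ := Real.sqrt (B ^ 2 + |Gmax| + δ + 1) + B + 1 with hR
    have hRpos : 0 < R := by rw [hR]; positivity
    have hRB : B + 1 ≤ R := by rw [hR]; linarith [Real.sqrt_nonneg (B ^ 2 + |Gmax| + δ + 1)]
    have hR2 : B ^ 2 + |Gmax| + δ + 1 ≤ R ^ 2 := by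
      have h1 : Real.sqrt (B ^ 2 + |Gmax| + δ + 1) ≤ R := by rw [hR]; linarith
      have h2 : 0 ≤ Real.sqrt (B ^ 2 + |Gmax| + δ + 1) := Real.sqrt_nonneg _
      calc B ^ 2 + |Gmax| + δ + 1 = Real.sqrt (B ^ 2 + |Gmax| + δ + 1) ^ 2 := (Real.sq_sqrt (by positivity)).symm
        _ ≤ R ^ 2 := pow_le_pow_left₀ h2 h1 2
    -- the functions
    set ρ : EuclideanSpace ℝ (Fin 3) → ℝ := fun x => ‖x‖ ^ 2 - R ^ 2 with hρ
    have hρs : ContDiff ℝ ∞ ρ := (contDiff_norm_sq ℝ).sub contDiff_const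
    have hρd : ∀ x, HasFDerivAt ρ (2 • innerSL ℝ x) x := fun x => by
      have := (hasStrictFDerivAt_norm_sq x).hasFDerivAt.sub_const (R ^ 2)
      exact this
    set FX : EuclideanSpace ℝ (Fin 3) → ℝ := fun x => -G x + δ * P ((ρ x - -G x) / δ) with hFX
    have hFXs : ContDiff ℝ ∞ FX := SmoothMax.contDiff_smax hPs hG.neg hρs
    have hGout : ∀ x, x ∉ K' → 2 * δ < G x := fun x hx => by
      have : ¬ G x ≤ ε₀ := fun h => hx (hGK x h)
      rw [hδ]; linarith [not_le.1 this]
    -- region A (`ρ < -G - δ`, containing the ball of radius `B`): `F_X = -G`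
    have hA_of : ∀ x, ‖x‖ ≤ B → ρ x < -G x - δ := by
      intro x hx
      have hGx : G x ≤ |Gmax| := (hGmax x (mem_closedBall_zero_iff.2 hx)).trans (le_abs_self _)
      have hx2 : ‖x‖ ^ 2 ≤ B ^ 2 := pow_le_pow_left₀ (norm_nonneg _) hx 2
      show ‖x‖ ^ 2 - R ^ 2 < -G x - δ
      linarith
    have hFX_A : ∀ x, ρ x ≤ -G x - δ → FX x = -G x := fun x hx =>
      SmoothMax.smax_eq_left hP0 hδ0 hx
    have hFX_C : ∀ x, -G x ≤ ρ x - δ → FX x = ρ x := fun x hx =>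
      SmoothMax.smax_eq_right hP1 hδ0 hx
    have hAopen : IsOpen {x | ρ x < -G x - δ} :=
      isOpen_lt hρs.continuous ((hG.continuous.neg).sub continuous_const)
    have hCopen : IsOpen {x | -G x < ρ x - δ} :=
      isOpen_lt hG.continuous.neg (hρs.continuous.sub continuous_const)
    -- the zero set
    have hzero : ∀ x, FX x = 0 ↔ G x = 0 ∨ ‖x‖ = R := by
      intro x
      constructor
      · intro h0
        by_cases hxK : x ∈ K'
        · left
          have hxA := hA_of x (mem_closedBall_zero_iff.1 (hKB hxK))
          have := hFX_A x hxA.le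
          rw [h0] at this; linarith
        · right
          have hG2 := hGout x hxK
          obtain ⟨-, hρ0⟩ := SmoothMax.le_zero_of_smax_nonpos hPge hδ0 (u := -G x) (v := ρ x) (le_of_eq h0)
          have hup := SmoothMax.smax_le_max_add hPle hδ0 (-G x) (ρ x)
          have hmax : -δ ≤ max (-G x) (ρ x) := by
            have : FX x = -G x + δ * P ((ρ x - -G x) / δ) := rfl
            linarith
          have hρge : -δ ≤ ρ x := by
            rcases le_or_gt (ρ x) (-G x) with h | h
            · rw [max_eq_left h] at hmax; linarith
            · rw [max_eq_right h.le] at hmax; exact hmax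
          have hxC : -G x ≤ ρ x - δ := by linarith
          have := hFX_C x hxC
          rw [h0] at this
          have hρ0' : ρ x = 0 := this.symm
          have h2 : ‖x‖ ^ 2 = R ^ 2 := by simp only [hρ] at hρ0'; linarith
          exact (sq_eq_sq₀ (norm_nonneg x) hRpos.le).1 h2
      · rintro (hG0 | hxR)
        · have hxA := hA_of x (mem_closedBall_zero_iff.1 (hKB (hZK x hG0)))
          rw [hFX_A x hxA.le, hG0, neg_zero]
        · have hxK : x ∉ K' := fun h => by
            have := mem_closedBall_zero_iff.1 (hKB h); rw [hxR] at this; linarith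
          have hρx : ρ x = 0 := by simp only [hρ, hxR, sub_self]
          have hxC : -G x ≤ ρ x - δ := by rw [hρx]; linarith [hGout x hxK]
          rw [hFX_C x hxC, hρx]
    refine ⟨FX, sphere 0 R, R, δ / 2, hFXs, by positivity, ?_, ?_, ?_, ?_, isClosed_sphere, hRpos, ?_, ?_, ?_, ?_⟩
    · -- compact sublevel set
      refine Metric.isCompact_of_isClosed_isBounded (isClosed_le hFXs.continuous continuous_const) ?_
      refine (isBounded_closedBall (x := (0 : EuclideanSpace ℝ (Fin 3))) (r := Real.sqrt (R ^ 2 + δ))).subset ?_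
      intro x hx
      have hx' : FX x ≤ δ / 2 := hx
      rw [mem_closedBall_zero_iff]
      have hsq_le : ‖x‖ ^ 2 ≤ R ^ 2 + δ := by
        by_cases hxK : x ∈ K'
        · have := mem_closedBall_zero_iff.1 (hKB hxK)
          have h1 : ‖x‖ ^ 2 ≤ B ^ 2 := pow_le_pow_left₀ (norm_nonneg _) this 2
          nlinarith
        · have hG2 := hGout x hxK
          by_cases hxC : -G x ≤ ρ x - δ
          · rw [hFX_C x hxC] at hx'
            simp only [hρ] at hx'; linarith
          · push Not at hxC
            have : ρ x < -δ := by linarith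
            simp only [hρ] at this; linarith
      calc ‖x‖ = Real.sqrt (‖x‖ ^ 2) := (Real.sqrt_sq (norm_nonneg _)).symm
        _ ≤ Real.sqrt (R ^ 2 + δ) := Real.sqrt_le_sqrt hsq_le
    · -- regularity
      intro x hx
      rcases (hzero x).1 hx with hG0 | hxR
      · have hxA := hA_of x (mem_closedBall_zero_iff.1 (hKB (hZK x hG0)))
        have hev : FX =ᶠ[𝓝 x] fun y => -G y := by
          filter_upwards [hAopen.mem_nhds hxA] with y hy using hFX_A y (le_of_lt hy)
        rw [hev.fderiv_eq]
        have : (fun y => -G y) = -G := rfl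
        rw [this, fderiv_neg, Ne, neg_eq_zero]
        exact hreg x hG0
      · have hxK : x ∉ K' := fun h => by
          have := mem_closedBall_zero_iff.1 (hKB h); rw [hxR] at this; linarith
        have hρx : ρ x = 0 := by simp only [hρ, hxR, sub_self]
        have hxC : -G x < ρ x - δ := by rw [hρx]; linarith [hGout x hxK]
        have hev : FX =ᶠ[𝓝 x] ρ := by
          filter_upwards [hCopen.mem_nhds hxC] with y hy using hFX_C y (le_of_lt hy)
        rw [hev.fderiv_eq, (hρd x).fderiv]
        intro h0
        have h1 := congrArg (fun T : EuclideanSpace ℝ (Fin 3) →L[ℝ] ℝ => T x) h0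
        have h2 : (2 • innerSL ℝ x : EuclideanSpace ℝ (Fin 3) →L[ℝ] ℝ) x = 2 * ‖x‖ ^ 2 := by
          simp only [FunLike.coe_smul, Pi.smul_apply, innerSL_apply_apply, real_inner_self_eq_norm_sq, nsmul_eq_mul,
            Nat.cast_ofNat]
        have h3 : (0 : EuclideanSpace ℝ (Fin 3) →L[ℝ] ℝ) x = 0 := rfl
        simp only [h2, h3, hxR] at h1
        have : R ^ 2 = 0 := by linarith
        exact hRpos.ne' (pow_eq_zero_iff two_ne_zero |>.1 this)
    · -- the tube normal form
      intro x h1 h2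
      have hxT : x ∈ Tube := ⟨h1, h2⟩
      have hxA := hA_of x (mem_closedBall_zero_iff.1 (hTB hxT))
      rw [hFX_A x hxA.le, hNF x h1 h2, hσm]; ring
    · -- the zero set
      ext x
      simp only [mem_setOf_eq, mem_union, mem_sphere_zero_iff_norm]
      exact hzero x
    · intro x hx; rw [mem_sphere_zero_iff_norm.1 hx]
    · exact fun x hx => mem_ball_zero_iff.2 (lt_of_le_of_lt (mem_closedBall_zero_iff.1 (hKB hx)) (by linarith))
    · exact fun x hx => mem_ball_zero_iff.2 (lt_of_le_of_lt (mem_closedBall_zero_iff.1 (hTB hx)) (by linarith))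
    · intro x hx hG0
      have hxK : x ∉ K' := fun h => by
        have := mem_closedBall_zero_iff.1 (hKB h); rw [mem_sphere_zero_iff_norm.1 hx] at this; linarith
      have := hGout x hxK
      rw [hG0] at this; linarith

end Literature.Topology.FourManifolds.SolidFunction
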